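import Summits.QuantumFields.BalabanUV.T4Continuum.E3Cert.ZL2d4DeficitAllU.D_zL2d4DeficitAllU_b0_g0
import Summits.QuantumFields.BalabanUV.T4Continuum.E3Cert.ZL2d4DeficitAllU.D_zL2d4DeficitAllU_b0_l0
import Summits.QuantumFields.BalabanUV.T4Continuum.E3Cert.ZL2d4DeficitAllU.D_zL2d4DeficitAllU_b0_g1
import Summits.QuantumFields.BalabanUV.T4Continuum.E3Cert.ZL2d4DeficitAllU.D_zL2d4DeficitAllU_b0_l1
import Summits.QuantumFields.BalabanUV.T4Continuum.E3Cert.ZL2d4DeficitAllU.D_zL2d4DeficitAllU_b0_g2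
import Summits.QuantumFields.BalabanUV.T4Continuum.E3Cert.ZL2d4DeficitAllU.D_zL2d4DeficitAllU_b0_l2
import Summits.QuantumFields.BalabanUV.T4Continuum.E3Cert.E3PolyCertZ
/-! E3 certificate package `ZL2d4DeficitAllU` — module `D_b0` ((4,2,1) = one L = 2 block in d = 4, SU(2) ≅ S³ links in the quaternion model,
ALL-U per-link DEFICIT law γ(x) = 1013∕1024 − (241∕1024)·Σ_tΠ_t(1−u₀); emitter `bal_e3_lean_emit.py` output for `block-L2d4-su2-deficit-allU-dyadic.json`,
lane `run/shared/lean/ttrl/balaban-calc/e3/lean-draft/tree/zL2d4DeficitAllU/D_b0.lean`; TREE COPY by the substrate cell (E3 hand of record, typer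
rulings (μ3)∕(μ3′)∕(μ6), journal l.19196 ∕ l.19672): import prefix substituted and one-line docstrings added BY SCRIPT, no literal touched).  Meaning of
the certificate: see `Data.lean` ∕ `Main.lean` of this package and the checker `E3Cert/E3PolyCertZ*.lean`.  HONEST: certified computation on ONE
small block — NOT Prop. (1.8), NOT an input of any NE row today, NOT infinite volume ∕ mass gap ∕ Clay. -/
set_option maxRecDepth 200000
set_option maxHeartbeats 0
namespace E3Z
/-- E3 certificate `zL2d4DeficitAllU` component: `zL2d4DeficitAllU_b0` (lane output, transcribed verbatim; see the module docstring). -/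
def zL2d4DeficitAllU_b0 : GramBlock := { rows := [(0,0),(0,1),(0,2),(0,3),(0,4),(0,5),(0,6),(0,7),(0,8),(0,9),(0,10),(0,11),(0,12),(0,13),(0,14),(0,15),(0,16),(0,17),(0,18),(0,19),(0,20),(0,21),(0,22),(0,23),(0,24),(0,25),(0,26),(0,27),(0,28),(0,29),(0,30),(0,31),(0,32),(0,33),(0,34),(0,35),(0,36),(0,37),(0,38),(0,39),(0,40),(0,41),(0,42),(0,43),(0,44),(0,45),(0,46),(0,47),(0,48),(0,49),(0,50),(0,51),(0,52),(0,53),(0,54),(0,55),(0,56),(0,57),(0,58),(0,59),(0,60),(0,61),(0,62),(0,63)], gden := 1048576, gnum := zL2d4DeficitAllU_b0_g0 ++ zL2d4DeficitAllU_b0_g1 ++ zL2d4DeficitAllU_b0_g2, lden := 24, lnum := zL2d4DeficitAllU_b0_l0 ++ zL2d4DeficitAllU_b0_l1 ++ zL2d4DeficitAllU_b0_l2 }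
end E3Z
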